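import Summits.ResolutionOfSingularities.ResolutionOfSingularities.Theorems.MarkedTransferCampaignW46ThreadChainStep
import Summits.ResolutionOfSingularities.ResolutionOfSingularities.Theorems.MarkedTransferCampaignW46ThreadChainDivisors
import HarnessLib

/-!
# [OURS · L1 W4.6 rung (i-a)] Thread chains, V: the exceptional bookkeeping along one quadratic transform — the prime
# divisors through the next point form a regular system of parameters, and the monomial `ξ^α η^β` transforms with
# strictly smaller total exponent
# (cell res-hironaka, LADDER-RESOLUTION rung L, D-0089; campaign s46, prover res-L1-s46-pv-1; host route MarkedTransfer,
# `--supports stmt-ResolutionOfSingularities-16155`)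

HONEST FRAMING. Nothing here is a statement of H. Hironaka's manuscript (2017-03-23, [Hironaka2017]). Pure commutative
algebra inside a field `F` (companions `…ThreadChainStep.lean`, `…ThreadChainDivisors.lean`): the one-step lemmas of the
EXCEPTIONAL END GAME of the thread-chain proof of rung (i-a). AI review is weaker than expert review. No `sorry`.

## Contents (for a quadratic transform `R → R₁` along `O` of two-dimensional regular local rings of `F`, `𝔪_R = (ξ, η)`,
## oriented by `ν(ξ) ≤ ν(η)` in additive notation — `O.valuation η ≤ O.valuation ξ`)

* `inv_step_of_le` — **the normal-crossings invariant propagates**: if every prime divisor `R_{(π)}` of `R` dominating a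
  fixed subring `R₀` is `R_{(ξ)}` or `R_{(η)}`, then `𝔪_{R₁} = (ξ, η')` and every prime divisor of `R₁` dominating `R₀`
  is `(R₁)_{(ξ)}` (the new exceptional prime) or `(R₁)_{(η')}`; here `η' = η/ξ` if `ν(ξ) < ν(η)` (satellite point) and
  `𝔪_{R₁} = (ξ, f)` otherwise (then no older prime divisor passes through `R₁`). Ingredients: the centre of a prime of
  `R₁` on `R` (`exists_prime_span_eq_comap`), maximality of prime divisors (`eq_of_ofPrime_span_le`), `η/ξ ∉ R_{(ξ)}`.
* `mono_step_of_le` — **the monomial transform**: for exponents `β < b ≤ α + β`, `𝔪_R R₁ = ξ R₁` and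
  `(ξ^α η^β) R₁ = ξ^b · (ξ'^{α'} η'^{β'}) R₁` for a regular system of parameters `(ξ', η')` of `R₁` with
  `α' + β' < α + β` (`(α+β-b, β)` on `(ξ, η/ξ)` at a satellite point, `(α+β-b, 0)` at a free point).
* helpers `valuation_le_of_mem_span_pair`, `div_not_mem_ofPrime_span`, `prime_of_span_pair`.

## References

* O. Zariski, P. Samuel, *Commutative Algebra* II (1960), Appendix 5 (proximity of infinitely near points). [ZariskiSamuel1960]
* C. Huneke, I. Swanson, *Integral Closure of Ideals, Rings, and Modules* (2006), Ch. 14. [HunekeSwanson2006]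
-/

noncomputable section

set_option linter.dupNamespace false -- mandated namespace of this single-conjunct summit

open IsLocalRing

namespace Summit.ResolutionOfSingularities.ResolutionOfSingularities.Theorems

namespace CampaignW46

open Literature.AlgebraicGeometry.Resolution

universe u

variable {F : Type u} [Field F]

/-! ## One step of the exceptional bookkeeping: the prime divisors through the next point -/

section ExcStep

variable {O : ValuationSubring F} {R₀ R R₁ : Subring F} [IsRegularLocalRing R] [IsRegularLocalRing R₁]

/-- Elements of `𝔪 = (ξ, η)` have value at most the larger of the values of `ξ`, `η`. [folklore] -/
theorem valuation_le_of_mem_span_pair (hRO : R ≤ O.toSubring) {ξ η : R}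
    (hm : maximalIdeal R = Ideal.span {ξ, η}) (hle : O.valuation (η : F) ≤ O.valuation (ξ : F)) :
    ∀ y ∈ maximalIdeal R, O.valuation (y : F) ≤ O.valuation (ξ : F) := by
  intro y hy
  rw [hm, Ideal.mem_span_pair] at hy
  obtain ⟨a, c, rfl⟩ := hy
  simp only [Subring.coe_add, Subring.coe_mul]
  refine (Valuation.map_add _ _ _).trans (max_le ?_ ?_)
  · rw [map_mul]
    calc O.valuation (a : F) * O.valuation (ξ : F) ≤ 1 * O.valuation (ξ : F) :=
          mul_le_mul' ((O.valuation_le_one_iff _).mpr (hRO a.2)) le_rfl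
      _ = O.valuation (ξ : F) := one_mul _
  · rw [map_mul]
    calc O.valuation (c : F) * O.valuation (η : F) ≤ 1 * O.valuation (ξ : F) :=
          mul_le_mul' ((O.valuation_le_one_iff _).mpr (hRO c.2)) hle
      _ = O.valuation (ξ : F) := one_mul _

/-- `η/ξ ∉ R_{(ξ)}` for a regular system of parameters `(ξ, η)` of a two-dimensional `R`. [folklore] -/
theorem div_not_mem_ofPrime_span (hdim : ringKrullDim R = 2) {ξ η : R} (hm : maximalIdeal R = Ideal.span {ξ, η})
    (hξ : Prime ξ) : haveI := isPrime_span_of_prime hξ;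
      (η : F) / (ξ : F) ∉ (LocalSubring.ofPrime R (Ideal.span {ξ})).toSubring := by
  intro hmem
  have hdvd : ξ ∣ η := (div_mem_ofPrime_span_iff hξ η).mp hmem
  apply maximalIdeal_ne_span_singleton hdim ξ
  rw [hm]
  apply le_antisymm
  · rw [Ideal.span_le]
    intro t ht
    rcases ht with ht | ht
    · rw [ht]; exact Ideal.mem_span_singleton_self _
    · rw [Set.mem_singleton_iff] at ht
      rw [ht]; exact Ideal.mem_span_singleton.mpr hdvd
  · exact Ideal.span_mono (Set.singleton_subset_iff.mpr (Set.mem_insert _ _))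

/-- Both members of a regular system of parameters of a two-dimensional regular local ring are prime. [folklore] -/
theorem prime_of_span_pair (hdim : ringKrullDim R = 2) {ξ η : R} (hm : maximalIdeal R = Ideal.span {ξ, η}) :
    Prime ξ ∧ Prime η := by
  have hξm : ξ ∈ maximalIdeal R := hm ▸ Ideal.subset_span (Set.mem_insert _ _)
  have hηm : η ∈ maximalIdeal R := hm ▸ Ideal.subset_span (Set.mem_insert_of_mem _ rfl)
  have hm' : maximalIdeal R = Ideal.span {η, ξ} := hm.trans Ideal.span_pair_comm
  obtain ⟨-, -, hξp, -⟩ := exists_maximalIdeal_eq_span_pair_of_not_mem_sq hdim hξm (fst_not_mem_sq hdim hm)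
  obtain ⟨-, -, hηp, -⟩ := exists_maximalIdeal_eq_span_pair_of_not_mem_sq hdim hηm (fst_not_mem_sq hdim hm')
  exact ⟨hξp, hηp⟩

/-- **The exceptional bookkeeping, one step (oriented: `ν(ξ) ≤ ν(η)`, i.e. `ξ` is a chart element).** Let `R → R₁` be a
quadratic transform along `O` of two-dimensional regular local rings of `F`, `R₀ ⊆ R`, and `𝔪_R = (ξ, η)` such that every
prime divisor `R_{(π)}` of `R` DOMINATING `R₀` is `R_{(ξ)}` or `R_{(η)}`. Then `𝔪_{R₁} = (ξ', η')` with the same property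
for `R₁`: `ξ' = ξ` (the new exceptional prime) and `η' = η/ξ` when `ν(η) < ν(ξ)`, resp. `𝔪_{R₁} = (ξ, f)` when
`ν(ξ) = ν(η)` (then no old prime divisor passes through `R₁`). [cite: ZariskiSamuel1960, Appendix 5] -/
theorem inv_step_of_le (hdim : ringKrullDim R = 2) (hdim₁ : ringKrullDim R₁ = 2) (hRF : IsLocalRingOf R)
    (hst : IsQuadraticTransformAlong O R R₁) (hRdom : SubringDominates R O.toSubring)
    (hdom₁ : SubringDominates R₁ O.toSubring) {ξ η : R} (hm : maximalIdeal R = Ideal.span {ξ, η})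
    (hle : O.valuation (η : F) ≤ O.valuation (ξ : F))
    (hinv : ∀ (π : R) (hπ : Prime π), (haveI := isPrime_span_of_prime hπ;
      SubringDominates R₀ (LocalSubring.ofPrime R (Ideal.span {π})).toSubring) →
      Ideal.span {π} = Ideal.span {ξ} ∨ Ideal.span {π} = Ideal.span {η}) :
    ∃ (hξ1 : (ξ : F) ∈ R₁) (η' : R₁), maximalIdeal R₁ = Ideal.span {⟨ξ, hξ1⟩, η'} ∧
      (O.valuation (η : F) < O.valuation (ξ : F) → (η' : F) = (η : F) / (ξ : F)) ∧
      ∀ (π' : R₁) (hπ' : Prime π'), (haveI := isPrime_span_of_prime hπ';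
        SubringDominates R₀ (LocalSubring.ofPrime R₁ (Ideal.span {π'})).toSubring) →
        Ideal.span {π'} = Ideal.span {(⟨ξ, hξ1⟩ : R₁)} ∨ Ideal.span {π'} = Ideal.span {η'} := by
  classical
  have hRO := hst.source_le
  have hR₁F : ∀ z : F, ∃ a ∈ R₁, ∃ b ∈ R₁, b ≠ 0 ∧ z = a / b := fun z => by
    obtain ⟨a, ha, c, hc, hc0, rfl⟩ := hRF.2 z; exact ⟨a, hst.le ha, c, hst.le hc, hc0, rfl⟩
  obtain ⟨hξp, hηp⟩ := prime_of_span_pair hdim hm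
  have hξm : ξ ∈ maximalIdeal R := hm ▸ Ideal.subset_span (Set.mem_insert _ _)
  have hηm : η ∈ maximalIdeal R := hm ▸ Ideal.subset_span (Set.mem_insert_of_mem _ rfl)
  have hξ0 : ξ ≠ 0 := hξp.ne_zero
  have hξ0F : (ξ : F) ≠ 0 := fun e => hξ0 (Subtype.ext e)
  have hmax : ∀ y ∈ maximalIdeal R, O.valuation (y : F) ≤ O.valuation (ξ : F) :=
    valuation_le_of_mem_span_pair hRO hm hle
  -- the chart element `ξ`: prime in `R₁`, and `η/ξ ∈ R₁`
  obtain ⟨hξ1, hξp1, -, -, -⟩ := prime_chart_succ hdim hdim₁ hst hRdom hξm hξ0 hmax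
  have ht1 : (η : F) / (ξ : F) ∈ R₁ := div_mem_of_forall_le hst ξ.2 (by simpa using hξm) hξ0F hmax η.2 (by simpa using hηm)
  -- classification of the young primes of `R₁`
  have hclass : ∀ (π' : R₁) (hπ' : Prime π'), (haveI := isPrime_span_of_prime hπ';
      SubringDominates R₀ (LocalSubring.ofPrime R₁ (Ideal.span {π'})).toSubring) →
      Ideal.span {π'} = Ideal.span {(⟨ξ, hξ1⟩ : R₁)} ∨
        (haveI := isPrime_span_of_prime hπ'; haveI := isPrime_span_of_prime hηp;
          (LocalSubring.ofPrime R₁ (Ideal.span {π'})).toSubring =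
            (LocalSubring.ofPrime R (Ideal.span {η})).toSubring) := by
    intro π' hπ' hyoung
    haveI := isPrime_span_of_prime hπ'
    by_cases hdvd : π' ∣ Subring.inclusion hst.le ξ
    · left
      have hassoc : Associated π' (⟨ξ, hξ1⟩ : R₁) :=
        hπ'.associated_of_dvd hξp1 hdvd
      exact Ideal.span_singleton_eq_span_singleton.mpr hassoc
    · right
      obtain ⟨π₁, hπ₁, hc, hW⟩ := exists_prime_span_eq_comap hdim hRF.2 hst.le hπ' hξm hdvd
      haveI := isPrime_span_of_prime hπ₁
      -- `R_{(π₁)} = R₁_{(π')}` by maximality; so `R_{(π₁)}` is young, hence `(π₁) = (ξ)` or `(η)`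
      have heq := eq_of_ofPrime_span_le hπ₁ hRF.2 hW (inv_not_mem_ofPrime_span hπ')
      have hyoung₁ : SubringDominates R₀ (LocalSubring.ofPrime R (Ideal.span {π₁})).toSubring := by
        rw [← heq]; exact hyoung
      rcases hinv π₁ hπ₁ hyoung₁ with h1 | h1
      · -- `R₁ ⊆ R_{(ξ)}` is impossible: `η/ξ ∉ R_{(ξ)}`
        exfalso
        have hle1 : R₁ ≤ (LocalSubring.ofPrime R (Ideal.span {π₁})).toSubring :=
          heq ▸ LocalSubring.le_ofPrime _ _
        rw [ofPrime_span_congr hπ₁ hξp h1] at hle1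
        exact div_not_mem_ofPrime_span hdim hm hξp (hle1 ht1)
      · rw [heq, ofPrime_span_congr hπ₁ hηp h1]
  rcases hle.lt_or_eq with hlt | heqv
  · -- `ν(η) < ν(ξ)`: `𝔪₁ = (ξ, η/ξ)`
    have hlt' : O.valuation ((η : F) / (ξ : F)) < 1 := by
      rw [map_div₀, div_lt_one₀ (pos_iff_ne_zero.mpr ((map_ne_zero _).mpr hξ0F))]; exact hlt
    obtain ⟨hξ1', ht1', hm₁⟩ := maximalIdeal_eq_span_pair hst hRdom hdom₁ ξ.2 η.2 (by simpa using hm) hξ0F hlt'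
    refine ⟨hξ1, ⟨(η : F) / (ξ : F), ht1⟩, hm₁, fun _ => rfl, fun π' hπ' hyoung => ?_⟩
    rcases hclass π' hπ' hyoung with h1 | h1
    · exact Or.inl h1
    · right
      haveI := isPrime_span_of_prime hπ'
      haveI := isPrime_span_of_prime hηp
      obtain ⟨-, htp⟩ := prime_of_span_pair hdim₁ hm₁
      haveI := isPrime_span_of_prime htp
      -- `R_{(η)} ⊆ R₁_{(η/ξ)}`, hence equal, hence `= R₁_{(π')}`; compare centres
      have hle2 : (LocalSubring.ofPrime R (Ideal.span {η})).toSubring ≤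
          (LocalSubring.ofPrime R₁ (Ideal.span {(⟨(η : F) / (ξ : F), ht1⟩ : R₁)})).toSubring := by
        have hndvd : ¬ (⟨(η : F) / (ξ : F), ht1⟩ : R₁) ∣ Subring.inclusion hst.le ξ := by
          intro hd
          have hassoc : Associated (⟨(η : F) / (ξ : F), ht1⟩ : R₁) ⟨ξ, hξ1⟩ := htp.associated_of_dvd hξp1 hd
          apply maximalIdeal_ne_span_singleton hdim₁ (⟨ξ, hξ1⟩ : R₁)
          rw [hm₁]
          apply le_antisymm
          · rw [Ideal.span_le]
            intro t ht
            rcases ht with ht | ht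
            · rw [ht]; exact Ideal.mem_span_singleton_self _
            · rw [Set.mem_singleton_iff] at ht
              rw [ht, SetLike.mem_coe, ← Ideal.span_singleton_le_iff_mem,
                Ideal.span_singleton_eq_span_singleton.mpr hassoc]
          · exact Ideal.span_mono (Set.singleton_subset_iff.mpr (Set.mem_insert _ _))
        obtain ⟨π₁, hπ₁, hc, hW⟩ := exists_prime_span_eq_comap hdim hRF.2 hst.le htp hξm hndvd
        haveI := isPrime_span_of_prime hπ₁
        -- `η ∈ centre = (π₁)`, so `(π₁) = (η)`
        have hηc : η ∈ Ideal.span {π₁} := by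
          rw [← hc, Ideal.mem_comap, Ideal.mem_span_singleton]
          refine ⟨⟨ξ, hξ1⟩, Subtype.ext ?_⟩
          change (η : F) = (η : F) / (ξ : F) * (ξ : F)
          rw [div_mul_cancel₀ _ hξ0F]
        have h1' : Ideal.span {π₁} = Ideal.span {η} := by
          have hd : π₁ ∣ η := Ideal.mem_span_singleton.mp hηc
          exact Ideal.span_singleton_eq_span_singleton.mpr (hπ₁.associated_of_dvd hηp hd)
        rw [← ofPrime_span_congr hπ₁ hηp h1']
        exact hW
      have heq2 := eq_of_ofPrime_span_le hηp hRF.2 hle2 (inv_not_mem_ofPrime_span htp)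
      -- now `R₁_{(π')} = R_{(η)} = R₁_{(η/ξ)}`: so `π' ∣ η/ξ`
      have heq3 : (LocalSubring.ofPrime R₁ (Ideal.span {π'})).toSubring =
          (LocalSubring.ofPrime R₁ (Ideal.span {(⟨(η : F) / (ξ : F), ht1⟩ : R₁)})).toSubring := h1.trans heq2.symm
      have ht0 : (⟨(η : F) / (ξ : F), ht1⟩ : R₁) ≠ 0 := htp.ne_zero
      have hdvd : π' ∣ (⟨(η : F) / (ξ : F), ht1⟩ : R₁) := by
        rw [← not_inv_mem_ofPrime_span_iff_dvd hπ' ht0, heq3]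
        exact inv_not_mem_ofPrime_span htp
      exact Ideal.span_singleton_eq_span_singleton.mpr (hπ'.associated_of_dvd htp hdvd)
  · -- `ν(ξ) = ν(η)`: no old prime divisor passes; `𝔪₁ = (ξ, f)`
    obtain ⟨hξ1', f, hm₁⟩ := exists_maximalIdeal_eq_span_chart hdim hst hRdom hξm hξ0 hmax
    refine ⟨hξ1, f, hm₁, fun hlt => absurd heqv hlt.ne, fun π' hπ' hyoung => ?_⟩
    rcases hclass π' hπ' hyoung with h1 | h1
    · exact Or.inl h1
    · exfalso
      haveI := isPrime_span_of_prime hπ'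
      haveI := isPrime_span_of_prime hηp
      -- `R₁ ⊆ R_{(η)}` is impossible: `ξ/η ∈ R₁` but `ξ/η ∉ R_{(η)}`
      have hη0F : (η : F) ≠ 0 := fun e => hηp.ne_zero (Subtype.ext e)
      have hmax' : ∀ y ∈ maximalIdeal R, O.valuation (y : F) ≤ O.valuation (η : F) :=
        fun y hy => (hmax y hy).trans heqv.symm.le
      have hs1 : (ξ : F) / (η : F) ∈ R₁ :=
        div_mem_of_forall_le hst η.2 (by simpa using hηm) hη0F hmax' ξ.2 (by simpa using hξm)
      have hle1 : R₁ ≤ (LocalSubring.ofPrime R (Ideal.span {η})).toSubring := h1 ▸ LocalSubring.le_ofPrime _ _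
      exact div_not_mem_ofPrime_span hdim (hm.trans Ideal.span_pair_comm) hηp (hle1 hs1)

/-- **The monomial transform, one step (oriented: `ν(η) ≤ ν(ξ)`).** With `𝔪_R = (ξ, η)` and exponents `α, β < b ≤ α + β`:
`𝔪_R R₁ = ξ R₁` and `(ξ^α η^β) R₁ = ξ^b · (ξ'^{α'} η'^{β'})` for a regular system of parameters `(ξ', η')` of `R₁` and
exponents with `α' + β' < α + β` — namely `ξ^{α+β-b} (η/ξ)^β` when `ν(η) < ν(ξ)`, and `ξ^{α+β-b} ·` unit when
`ν(ξ) = ν(η)`. [cite: ZariskiSamuel1960, Appendix 5] -/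
theorem mono_step_of_le (hdim : ringKrullDim R = 2)
    (hst : IsQuadraticTransformAlong O R R₁) (hRdom : SubringDominates R O.toSubring)
    (hdom₁ : SubringDominates R₁ O.toSubring) {ξ η : R} (hm : maximalIdeal R = Ideal.span {ξ, η})
    (hle : O.valuation (η : F) ≤ O.valuation (ξ : F)) {b α β : ℕ} (hb : 0 < b) (hβb : β < b)
    (hsum : b ≤ α + β) :
    ∃ (hξ1 : (ξ : F) ∈ R₁) (ξ' η' : R₁) (α' β' : ℕ), maximalIdeal R₁ = Ideal.span {ξ', η'} ∧ α' + β' < α + β ∧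
      extIdeal (maximalIdeal R) R₁ = Ideal.span {(⟨ξ, hξ1⟩ : R₁)} ∧
      Ideal.span {(⟨ξ, hξ1⟩ : R₁) ^ b} * Ideal.span {ξ' ^ α' * η' ^ β'} = extIdeal (Ideal.span {ξ ^ α * η ^ β}) R₁ := by
  classical
  have hRO := hst.source_le
  obtain ⟨hξp, hηp⟩ := prime_of_span_pair hdim hm
  have hξm : ξ ∈ maximalIdeal R := hm ▸ Ideal.subset_span (Set.mem_insert _ _)
  have hηm : η ∈ maximalIdeal R := hm ▸ Ideal.subset_span (Set.mem_insert_of_mem _ rfl)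
  have hξ0 : ξ ≠ 0 := hξp.ne_zero
  have hξ0F : (ξ : F) ≠ 0 := fun e => hξ0 (Subtype.ext e)
  have hmax : ∀ y ∈ maximalIdeal R, O.valuation (y : F) ≤ O.valuation (ξ : F) :=
    valuation_le_of_mem_span_pair hRO hm hle
  have hξ1 : (ξ : F) ∈ R₁ := hst.le ξ.2
  have ht1 : (η : F) / (ξ : F) ∈ R₁ :=
    div_mem_of_forall_le hst ξ.2 (by simpa using hξm) hξ0F hmax η.2 (by simpa using hηm)
  set X : R₁ := ⟨ξ, hξ1⟩ with hX
  set T : R₁ := ⟨(η : F) / (ξ : F), ht1⟩ with hT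
  -- `𝔪_R R₁ = ξ R₁`
  have hmx : extIdeal (maximalIdeal R) R₁ = Ideal.span {X} := by
    rw [extIdeal_eq_map _ hst.le, hm, Ideal.map_span, Set.image_insert_eq, Set.image_singleton]
    apply le_antisymm
    · rw [Ideal.span_le]
      intro t ht
      rcases ht with ht | ht
      · rw [ht]; exact Ideal.mem_span_singleton_self _
      · rw [Set.mem_singleton_iff] at ht
        rw [ht, SetLike.mem_coe, Ideal.mem_span_singleton']
        exact ⟨T, Subtype.ext (by simp [hX, hT, div_mul_cancel₀ _ hξ0F])⟩
    · exact Ideal.span_mono (Set.singleton_subset_iff.mpr (Set.mem_insert _ _))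
  -- `(ξ^α η^β) R₁ = ξ^b (ξ^{α+β-b} T^β)`
  have hel : Subring.inclusion hst.le (ξ ^ α * η ^ β) = X ^ b * (X ^ (α + β - b) * T ^ β) := by
    apply Subtype.ext
    simp only [map_mul, map_pow, Subring.coe_mul, SubmonoidClass.coe_pow, hX, hT, Subring.coe_inclusion]
    have e1 : (ξ : F) ^ b * (ξ : F) ^ (α + β - b) = (ξ : F) ^ α * (ξ : F) ^ β := by
      rw [← pow_add, Nat.add_sub_cancel' hsum, pow_add]
    have hξβ : (ξ : F) ^ β ≠ 0 := pow_ne_zero β hξ0F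
    symm
    calc (ξ : F) ^ b * ((ξ : F) ^ (α + β - b) * ((η : F) / (ξ : F)) ^ β)
        = ((ξ : F) ^ b * (ξ : F) ^ (α + β - b)) * (η : F) ^ β / (ξ : F) ^ β := by rw [div_pow]; ring
      _ = ((ξ : F) ^ α * (ξ : F) ^ β) * (η : F) ^ β / (ξ : F) ^ β := by rw [e1]
      _ = (ξ : F) ^ α * (η : F) ^ β := by field_simp
  have hext : extIdeal (Ideal.span {ξ ^ α * η ^ β}) R₁ = Ideal.span {X ^ b} * Ideal.span {X ^ (α + β - b) * T ^ β} := by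
    rw [extIdeal_eq_map _ hst.le, Ideal.map_span, Set.image_singleton, hel, Ideal.span_singleton_mul_span_singleton]
  rcases hle.lt_or_eq with hlt | heqv
  · -- `ν(η) < ν(ξ)`: `𝔪₁ = (ξ, η/ξ)`, exponents `(α + β - b, β)`
    have hlt' : O.valuation ((η : F) / (ξ : F)) < 1 := by
      rw [map_div₀, div_lt_one₀ (pos_iff_ne_zero.mpr ((map_ne_zero _).mpr hξ0F))]; exact hlt
    obtain ⟨hξ1', ht1', hm₁⟩ := maximalIdeal_eq_span_pair hst hRdom hdom₁ ξ.2 η.2 (by simpa using hm) hξ0F hlt'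
    refine ⟨hξ1, X, T, α + β - b, β, hm₁, by omega, hmx, ?_⟩
    rw [hext]
  · -- `ν(ξ) = ν(η)`: `T` is a unit, `𝔪₁ = (ξ, f)`, exponents `(α + β - b, 0)`
    obtain ⟨hξ1', f, hm₁⟩ := exists_maximalIdeal_eq_span_chart hdim hst hRdom hξm hξ0 hmax
    have hη0F : (η : F) ≠ 0 := fun e => hηp.ne_zero (Subtype.ext e)
    have hmax' : ∀ y ∈ maximalIdeal R, O.valuation (y : F) ≤ O.valuation (η : F) :=
      fun y hy => (hmax y hy).trans (le_of_eq heqv.symm)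
    have hTu : IsUnit T := isUnit_div_of_forall_le hst ξ.2 η.2 (by simpa using hξm) (by simpa using hηm) hξ0F hη0F hmax hmax'
    refine ⟨hξ1, X, f, α + β - b, 0, hm₁, by omega, hmx, ?_⟩
    rw [hext, pow_zero, mul_one]
    congr 1
    exact Ideal.span_singleton_eq_span_singleton.mpr ⟨(hTu.pow β).unit, by rw [IsUnit.unit_spec]⟩

end ExcStep

end CampaignW46

end Summit.ResolutionOfSingularities.ResolutionOfSingularities.Theorems

end
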